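import Summits.MatrixMultiplication.OmegaCensus.STPP222Pow5From94Routes

/-!
# ω-census, `N₆` assembly: the Boolean route checker `covered6` and its soundness

HONEST FRAMING (pub-omega census; verbatim): lottery ticket; floor = certified bounds/negative ranges.
Census STRUCTURE bookkeeping (question Q7 of the pub-omega cell, the uniform threshold `N₆` for six simultaneous-TPP triples of
2-subsets), not progress on `ω`: a `(2,2,2)⁶` family certifies no matrix-multiplication bound of interest.

The `k = 6` twin of `STPP222Pow5From94Routes.lean`, with NO seeds: for a multiset `M` of prime-power moduli, `covered6 M` checks
(R1) some modulus `x ≥ 3` leaves a rest of product `≥ 46` (`(2,2,2)³` on the rest by `N₃ = 46`, times a tricolored-sum-free PAIR of `ℤ/x`: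
`3·2 = 6` triples), or (R3) `M = A + B` with `(2,2,2)^a` on the `A`-block (`host`, as for `k = 5`) and a tricolored-sum-free set of size
`need6 a = ⌈6/a⌉ ∈ {2, 3, 6}` on the `B`-block (`tsfGE6`: one coordinate with `tsfCyc6` — size `6` from `ℤ/e`, `e ≥ 18`, by the kernel
instances `ℤ/18, ℤ/19, ℤ/20` and the midpoint-free set `{0,1,3,7,8,10}` for `e ≥ 21` —, a coprime pair, an order-16 table type, or recursively
the TSF graph / a TSF product on a split).  `covered6_sound`: if the moduli of a block pass `covered6` then `(2,2,2)⁶ ⊆ Π j, ℤ/q j`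
(kit `STPP222Pow5AssemblyKit.lean`).  The kernel decision and the law `N₆ ≤ 290` are in `STPP222Pow6From290.lean`; exact Python
mirror: the seat's `model6b.py` (HOME `pub-omega-stpp-3-g11/code/`).

References: H. Cohn, R. Kleinberg, B. Szegedy, C. Umans, FOCS 2005 (arXiv:math/0511460), Def. 5.1; J. Blasiak et al., Discrete
Analysis 2017:3, Def. 3.1.  Seat pub-omega-stpp-3 (gen 11), 2026-08-25.
-/

open Literature.Computability.AlgebraicComplexity Literature.Combinatorics.Additive Finset

namespace Summit.MatrixMultiplication.OmegaCensus

namespace N6From290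

open N5Kit N5From94

/-! ## 1. Tricolored sum-free sets of size 6 in cyclic groups -/

/-- The TSF size this file extracts from `ℤ/e`: `6` for `e ≥ 18`, else `tsfCyc e`. -/
def tsfCyc6 (e : ℕ) : ℕ := if 18 ≤ e then 6 else tsfCyc e

/-- **`ℤ/e` carries a tricolored sum-free set of size `tsfCyc6 e`**: kernel instances for `e = 18, 19, 20` (seat search), the
midpoint-free set `{0,1,3,7,8,10}` for `e ≥ 21`, and `hasTSF_zmod_tsfCyc` below `18`. [cite: BlasiakChurchCohnGrochowNaslundSawinUmans2017, Def. 3.1] -/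
theorem hasTSF_zmod_tsfCyc6 (e : ℕ) : HasTSF (ZMod e) (tsfCyc6 e) := by
  unfold tsfCyc6
  by_cases h18 : 18 ≤ e
  · rw [if_pos h18]
    by_cases h21 : 21 ≤ e
    · exact hasTSF_zmod_of_midpointFree ![0, 1, 3, 7, 8, 10] (by decide) (fun i => by fin_cases i <;> simp <;> omega)
    interval_cases e
    · exact ⟨![0, 1, 3, 9, 13, 16], ![0, 1, 3, 14, 12, 13], ![0, 16, 12, 13, 11, 7], by unfold IsTricoloredSumFree; decide⟩
    · exact ⟨![0, 1, 3, 4, 9, 13], ![0, 1, 3, 7, 9, 4], ![0, 17, 13, 8, 1, 2], by unfold IsTricoloredSumFree; decide⟩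
    · exact ⟨![0, 1, 3, 4, 7, 9], ![0, 1, 3, 7, 12, 9], ![0, 18, 14, 9, 1, 2], by unfold IsTricoloredSumFree; decide⟩
  · rw [if_neg h18]
    exact hasTSF_zmod_tsfCyc e

/-! ## 2. The Boolean route checker for `k = 6` -/

/-- Base TSF supplies of a block with moduli `B`, size `≥ t` (as `tsfBase`, with `tsfCyc6`). -/
def tsfBase6 (t : ℕ) (B : Multiset ℕ) : Bool :=
  decide (t ≤ 1) || anyM B (fun x => decide (t ≤ tsfCyc6 x)) ||
    anyM B (fun x => anyM (B.erase x) (fun y => decide (Nat.Coprime x y ∧ t ≤ tsfCyc6 (x * y)))) ||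
    (decide (t ≤ 6) && tables6.any (fun s => dom s B))

/-- TSF supplies with `fuel` levels of splitting (as `tsfGE`, with `tsfBase6`). -/
def tsfGE6 : ℕ → ℕ → Multiset ℕ → Bool
  | 0, t, B => tsfBase6 t B
  | fuel + 1, t, B => tsfBase6 t B ||
      anyM B.powerset (fun B₂ => decide (t ≤ B₂.prod ∧ t ≤ (B - B₂).prod) ||
        (tsfGE6 fuel 2 B₂ && tsfGE6 fuel ((t + 1) / 2) (B - B₂)))

/-- The TSF size needed next to `a` triples for six: `⌈6/a⌉`. -/
def need6 (a : ℕ) : ℕ := if a = 3 then 2 else if a = 2 then 3 else 6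

/-- **The route checker for `(2,2,2)⁶`**: (R1) a modulus `x ≥ 3` with rest of product `≥ 46`, or a split `M = A + B` with
`host A ≠ 0` and a TSF set of size `need6 (host A)` on `B`.  No seeds. -/
def covered6 (M : Multiset ℕ) : Bool :=
  anyM M (fun x => decide (3 ≤ x ∧ 46 * x ≤ M.prod)) ||
    anyM M.powerset (fun B => decide (host (M - B) ≠ 0) && tsfGE6 (Multiset.card M) (need6 (host (M - B))) B)

/-! ## 3. Soundness -/

variable {ι : Type} [Fintype ι] [DecidableEq ι] {q : ι → ℕ}

omit [Fintype ι] in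
/-- From ONE coordinate `i ∈ S`: `ℤ/q i ⊇` a TSF set of size `tsfCyc6 (q i)`. -/
theorem tsfOn_single6 (S : Finset ι) {i : ι} (hi : i ∈ S) {t : ℕ} (ht : t ≤ tsfCyc6 (q i)) : TSFOn q S t := by
  refine ⟨ZMod (q i), inferInstance, AddMonoidHom.single (fun j => ZMod (q j)) i,
    Pi.single_injective (M := fun j => ZMod (q j)) i, ?_, hasTSF_mono ht (hasTSF_zmod_tsfCyc6 (q i))⟩
  intro x j hj
  have hji : j ≠ i := fun h => hj (h ▸ hi)
  simp [Pi.single_eq_of_ne hji]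

omit [Fintype ι] in
/-- From a COPRIME PAIR of coordinates: an element of order `q i · q i'` spans `ℤ/(q i q i') ⊇` a TSF set of size `tsfCyc6 (q i q i')`. -/
theorem tsfOn_pair6 (S : Finset ι) {i i' : ι} (hi : i ∈ S) (hi' : i' ∈ S) (hcop : Nat.Coprime (q i) (q i')) {t : ℕ}
    (ht : t ≤ tsfCyc6 (q i * q i')) : TSFOn q S t := by
  set c : Π j, ZMod (q j) := Pi.single i 1 + Pi.single i' 1 with hcdef
  have ho1 : addOrderOf (Pi.single i (1 : ZMod (q i)) : Π j, ZMod (q j)) = q i := by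
    rw [← AddMonoidHom.single_apply, addOrderOf_injective _ (Pi.single_injective (M := fun j => ZMod (q j)) i),
      ZMod.addOrderOf_one]
  have ho2 : addOrderOf (Pi.single i' (1 : ZMod (q i')) : Π j, ZMod (q j)) = q i' := by
    rw [← AddMonoidHom.single_apply, addOrderOf_injective _ (Pi.single_injective (M := fun j => ZMod (q j)) i'),
      ZMod.addOrderOf_one]
  have hord : addOrderOf c = q i * q i' := by
    rw [hcdef, AddCommute.addOrderOf_add_eq_mul_addOrderOf_of_coprime (AddCommute.all _ _) (by rwa [ho1, ho2]), ho1, ho2]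
  have hsupp : ∀ j ∉ S, c j = 0 := by
    intro j hj
    have h1 : j ≠ i := fun h => hj (h ▸ hi)
    have h2 : j ≠ i' := fun h => hj (h ▸ hi')
    simp [hcdef, Pi.single_eq_of_ne h1, Pi.single_eq_of_ne h2]
  obtain ⟨φ, hφ, hφs⟩ := exists_emb_of_elem S c hsupp hord
  exact ⟨_, inferInstance, φ, hφ, hφs, hasTSF_mono ht (hasTSF_zmod_tsfCyc6 _)⟩

omit [Fintype ι] in
/-- Soundness of the base supplies. -/
theorem tsfBase6_sound (hq : ∀ i, 0 < q i) {t : ℕ} (S : Finset ι) (h : tsfBase6 t (S.val.map q) = true) :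
    TSFOn q S t := by
  simp only [tsfBase6, Bool.or_eq_true, Bool.and_eq_true, decide_eq_true_eq, anyM_iff, List.any_eq_true] at h
  rcases h with ((h1 | ⟨x, hx, hxt⟩) | ⟨x, hx, y, hy, hcop, hyt⟩) | ⟨h6, s, hs, hdom⟩
  · exact tsfOn_of_le_one S h1
  · obtain ⟨i, hi, rfl⟩ := Multiset.mem_map.1 hx
    exact tsfOn_single6 S hi hxt
  · obtain ⟨i, hi, rfl⟩ := Multiset.mem_map.1 hx
    obtain ⟨i', hi', rfl⟩ := Multiset.mem_map.1 (Multiset.mem_of_mem_erase hy)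
    exact tsfOn_pair6 S hi hi' hcop hyt
  · exact (tsfOn_of_dom hq S hdom (hasTSF_tables6 s hs)).mono (Subset.refl _) h6

/-- Soundness of `tsfGE6` (as `tsfGE_sound`). -/
theorem tsfGE6_sound (hq : ∀ i, 0 < q i) : ∀ (fuel t : ℕ) (S : Finset ι), tsfGE6 fuel t (S.val.map q) = true → TSFOn q S t
  | 0, _, S, h => tsfBase6_sound hq S h
  | fuel + 1, t, S, h => by
      rw [tsfGE6, Bool.or_eq_true] at h
      rcases h with h | h
      · exact tsfBase6_sound hq S h
      rw [anyM_iff] at h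
      obtain ⟨B₂, hB₂, h⟩ := h
      rw [Multiset.mem_powerset] at hB₂
      obtain ⟨T, hTS, hT⟩ := exists_subset_map_eq q S B₂ hB₂
      have hdiff : S.val.map q - B₂ = (S \ T).val.map q := by rw [← hT, map_val_sdiff q hTS]
      have hun : T ∪ S \ T = S := Finset.union_sdiff_of_subset hTS
      rw [hdiff, ← hT, Bool.or_eq_true, decide_eq_true_eq, Bool.and_eq_true] at h
      rw [← hun]
      rcases h with ⟨h2, h3⟩ | ⟨h2, h3⟩
      · exact tsfOn_graph hq Finset.disjoint_sdiff h2 h3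
      · exact (tsfOn_mul Finset.disjoint_sdiff (tsfGE6_sound hq fuel 2 T h2) (tsfGE6_sound hq fuel _ (S \ T) h3)).mono
          (Subset.refl _) (by omega)

/-- `a · need6 a ≥ 6` for `1 ≤ a ≤ 3`. -/
theorem six_le_mul_need6 {a : ℕ} (h0 : a ≠ 0) (h3 : a ≤ 3) : 6 ≤ a * need6 a := by
  have h1 : 1 ≤ a := Nat.pos_of_ne_zero h0
  unfold need6; interval_cases a <;> decide

omit [Fintype ι] [DecidableEq ι] in
/-- **PRODUCT STEP for any number of triples.** `(2,2,2)^a` on `S₁`, a TSF set of size `t` on a disjoint `S₂`, `n ≤ a·t` ⇒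
`(2,2,2)^n ⊆ Π j, ℤ/q j` (the kit's `hasPow_of_parts` with `n` in place of `5`). [cite: CohnKleinbergSzegedyUmans2005, Def. 5.1] -/
theorem hasPow_of_parts_le {S₁ S₂ : Finset ι} (hS : Disjoint S₁ S₂) {a t n : ℕ} (h₁ : STPPOn q S₁ a) (h₂ : TSFOn q S₂ t)
    (hn : n ≤ a * t) : HasPow (Π j, ZMod (q j)) n := by
  obtain ⟨H, _, φ, hφ, hφs, hH⟩ := h₁
  obtain ⟨K, _, ψ, hψ, hψs, s, u, v, hT⟩ := h₂
  have hHK : HasPow (H × K) (a * t) := exists_isSTPP_222pow_mul_of_tsf hH hT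
  have hinj : Function.Injective (φ.coprod ψ) :=
    coprod_injective_of_support φ ψ (fun j => j ∈ S₁) hφ hψ (fun x j hj => hφs x j hj)
      (fun y j hj => hψs y j (Finset.disjoint_left.1 hS hj))
  exact hasPow_mono hn (hasPow_map _ hinj hHK)

/-- **Soundness of the route checker for six triples**: if the multiset of moduli of a block `S` is `covered6`, then
`(2,2,2)⁶ ⊆ Π j, ℤ/q j`. [cite: CohnKleinbergSzegedyUmans2005, Def. 5.1] -/
theorem covered6_sound (hq : ∀ i, 0 < q i) (S : Finset ι) (h : covered6 (S.val.map q) = true) :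
    HasPow (Π j, ZMod (q j)) 6 := by
  simp only [covered6, Bool.or_eq_true, Bool.and_eq_true, decide_eq_true_eq, anyM_iff] at h
  rcases h with ⟨x, hx, h3, h46⟩ | ⟨B, hB, hhost, htsf⟩
  · obtain ⟨i, hi, rfl⟩ := Multiset.mem_map.1 hx
    have hsub : ({i} : Finset ι) ⊆ S := Finset.singleton_subset_iff.2 hi
    have hrest : (S.val.map q).prod = q i * ((S \ {i}).val.map q).prod := by
      rw [map_val_sdiff q hsub, ← Multiset.prod_erase hx]
      congr 1
      simp
    have h46' : 46 ≤ ((S \ {i}).val.map q).prod := Nat.le_of_mul_le_mul_left (by rw [← hrest]; linarith) (hq i)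
    exact hasPow_of_parts_le Finset.sdiff_disjoint (stppOn_three hq _ h46')
      (tsfOn_single6 {i} (Finset.mem_singleton_self i) (t := 2) (by unfold tsfCyc6 tsfCyc; split_ifs <;> omega)) (by norm_num)
  · rw [Multiset.mem_powerset] at hB
    obtain ⟨T, hTS, hT⟩ := exists_subset_map_eq q S B hB
    have hdiff : S.val.map q - B = (S \ T).val.map q := by rw [← hT, map_val_sdiff q hTS]
    rw [hdiff] at hhost htsf
    rw [← hT] at htsf
    exact hasPow_of_parts_le Finset.sdiff_disjoint (stppOn_host hq (S \ T) hhost) (tsfGE6_sound hq _ _ T htsf)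
      (six_le_mul_need6 hhost (host_le _))

end N6From290

end Summit.MatrixMultiplication.OmegaCensus
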